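import Literature.IUT.HodgeTheaters.LocalFrobenioidsWitness
import Mathlib.CategoryTheory.Category.Preorder
import Mathlib.CategoryTheory.Category.GaloisConnection
import Mathlib.CategoryTheory.Comma.Over.Basic
import Mathlib.Order.Hom.WithTopBot
import Mathlib.Algebra.Order.Group.OrderIso
import HarnessLib

/-!
# [IUTchI] Example 3.2: the "may be reconstructed category-theoretically" clauses are NOT
# consequences of the interface `BadLocalFrobenioid` (kernel counter-model)

Mochizuki, *Inter-universal Teichmüller theory I*, §3, Example 3.2 (iii), (vi) (a), (b), (e), (f),
kurims May-2020 manuscript pp. 69–73 [claim: Mochizuki2012, status: disputed]. abc-iut cell, WAVE-4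
(D-0067) cone-interior seat abc-iut-w4-d047; DAG nodes `IUTchI:Ex3.2(i)`–`(vi)`; companion of
`BadLocalFrobenioidClaimsWitness.lean` (all ten clauses hold on the trivial inhabitant).

`BadLocalFrobenioid.lean` (abc-iut-L5-t2) types the reconstruction sentences of Example 3.2 as
MODEL-RELATIVE `Prop`s on the interface `BadLocalFrobenioid l K_v`, in the reading of Remark 3.2.1 (i)
(`ReconstructibleAlong Φ`: every self-equivalence of the source lifts compatibly along the structure
functor `Φ`). THIS FILE shows that five of them — `DdashFromD` (vi)(a), `DThetaFromD` (vi)(b), `CFromF`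
(iii), `FdashFromC` (vi)(f), `FthetaFromF` (vi)(e) — do NOT follow from the interface fields: the
inhabitant `BadLocalFrobenioid.doubling l K_v` (every carrier the ordered set `WithTop ℤ` as a thin
category; the inclusions `D⊢_v ⊆ D_v`, `C_v ⊆ F̲_v`, `C⊢_v ⊆ C_v` the "doubling" order-embedding
`n ↦ 2n`, `⊤ ↦ ⊤`, which is full, faithful and reflective with reflector `n ↦ ⌈n/2⌉`; `Ÿ_v := ⊤`)
satisfies every field of the interface, while the shift self-equivalence `n ↦ n + 1` of `WithTop ℤ` does
not lift along doubling (parity). Hence these clauses are genuine hypotheses on the REAL construction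
(tempered Frobenioids of [EtTh] §5, [FrdII] Ex. 1.1), to be proved at merge — not dischargeable from the
interface ("verify-after-merge", plan/L5/DISCHARGE-L5.md §E), and not vacuous (companion file).
Nothing here concerns the objects of the text; typed ≠ proved; no side is taken on [IUTchIII] Cor. 3.12.
-/

noncomputable section

namespace Literature.IUT.HodgeTheaters

open CategoryTheory

namespace DoublingWitness

/-- The carrier of every category of the counter-model: `ℤ ∪ {⊤}` with its order, as a thin category.
[folklore] -/
abbrev W : Type := WithTop ℤ

/-- Doubling `n ↦ 2n` as an order embedding of `ℤ`. [folklore] -/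
def dblEmb : ℤ ↪o ℤ := OrderEmbedding.ofStrictMono (fun n => 2 * n) fun _ _ h => by dsimp; omega

/-- Doubling on `ℤ ∪ {⊤}` (`⊤ ↦ ⊤`). [folklore] -/
def dblW : W ↪o W := dblEmb.withTopMap

/-- Doubling on finite elements. [folklore] -/
@[simp] private theorem dblW_coe (n : ℤ) : dblW (n : W) = ((2 * n : ℤ) : W) := rfl

/-- Doubling fixes `⊤`. [folklore] -/
@[simp] private theorem dblW_top : dblW (⊤ : W) = ⊤ := rfl

/-- The doubling functor `D : W ⥤ W` (models the inclusions `D⊢_v ⊆ D_v`, `C_v ⊆ F̲_v`, …). [folklore] -/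
def dbl : W ⥤ W := dblW.monotone.functor

/-- `D` is full (an order embedding). [folklore] -/
instance dbl_full : dbl.Full := inferInstanceAs (dblW.monotone.functor).Full

/-- The reflector `⌈·/2⌉` on `ℤ`. [folklore] -/
def halfUp (k : ℤ) : ℤ := (k + 1) / 2

/-- `⌈·/2⌉ ⊣ (2·)` on `ℤ`. [folklore] -/
private theorem gc_int : GaloisConnection halfUp (fun n : ℤ => 2 * n) := fun k n => by
  simp only [halfUp]; omega

/-- The reflector on `ℤ ∪ {⊤}`. [folklore] -/
def halfW : W → W := WithTop.map halfUp

/-- `⌈·/2⌉ ⊣ doubling` on `ℤ ∪ {⊤}`. [folklore] -/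
private theorem gc_W : GaloisConnection halfW dblW := by
  intro a b
  induction a using WithTop.recTopCoe with
  | top =>
    induction b using WithTop.recTopCoe with
    | top => exact ⟨fun _ => le_top, fun _ => le_top⟩
    | coe n =>
      simp only [halfW, WithTop.map_top, dblW_coe, top_le_iff, WithTop.coe_ne_top]
  | coe k =>
    induction b using WithTop.recTopCoe with
    | top => exact ⟨fun _ => by rw [dblW_top]; exact le_top, fun _ => le_top⟩
    | coe n => simp only [halfW, WithTop.map_coe, dblW_coe, WithTop.coe_le_coe]; exact gc_int k n

/-- The reflector functor (models "`D_v → D⊢_v` left adjoint to the inclusion", [FrdII] Ex. 1.3 (ii)).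
[folklore] -/
def half : W ⥤ W := gc_W.monotone_l.functor

/-- The adjunction `half ⊣ dbl`. [folklore] -/
def adj : half ⊣ dbl := gc_W.adjunction

/-- Doubling into the slice over `⊤` (models `D^Θ_v ⊆ (D_v)_{Ÿ_v}` with `Ÿ_v := ⊤`). [folklore] -/
def dblOver : W ⥤ Over (⊤ : W) := dbl.toOver ⊤ (fun _ => homOfLE le_top) fun _ => Subsingleton.elim _ _

/-- `dblOver` is full. [folklore] -/
instance dblOver_full : dblOver.Full where
  map_surjective {Y Z} g :=
    ⟨homOfLE (dblW.le_iff_le.mp (show dbl.obj Y ≤ dbl.obj Z from g.left.le)),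
      Over.OverMorphism.ext (Subsingleton.elim _ _)⟩

/-- `dblOver` is faithful (its source is thin). [folklore] -/
instance dblOver_faithful : dblOver.Faithful := inferInstance

/-- The empty splitting `⊥` on `W` is preserved by every endofunctor. [folklore] -/
private theorem bot_isPreservedBy (Φ : W ⥤ W) :
    (Witness.botSplitting W).IsPreservedBy (Witness.botSplitting W) Φ :=
  fun _ => Submonoid.map_bot _

/-- The shift `n ↦ n + 1`, `⊤ ↦ ⊤`: a self-equivalence of `W`. [folklore] -/
def shift : W ≌ W := (OrderIso.addRight (1 : ℤ)).withTopCongr.equivalence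

/-- The shift on finite elements. [folklore] -/
@[simp] private theorem shift_functor_obj_coe (n : ℤ) : shift.functor.obj (n : W) = ((n + 1 : ℤ) : W) := rfl

/-- Parity: `2m + 1` is not a doubled element of `ℤ ∪ {⊤}`. [folklore] -/
private theorem shift_coe_dbl_ne (m : ℤ) (y : W) : shift.functor.obj (((2 * m : ℤ)) : W) ≠ dblW y := by
  rw [shift_functor_obj_coe]
  induction y using WithTop.recTopCoe with
  | top => exact WithTop.coe_ne_top
  | coe k => rw [dblW_coe, Ne, WithTop.coe_eq_coe]; omega

/-- **Parity obstruction**: the shift does not lift along doubling — there is no self-equivalence `e'`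
of `W` with `D ⋙ shift ≅ e' ⋙ D` (evaluate at `0`: `1 = 2·k` or `1 = ⊤`). [folklore] -/
private theorem not_exists_lift_shift : ¬ ∃ e' : W ≌ W, Nonempty (dbl ⋙ shift.functor ≅ e'.functor ⋙ dbl) := by
  rintro ⟨e', ⟨I⟩⟩
  have h := (I.app ((0 : ℤ) : W)).to_eq
  change shift.functor.obj (dblW ((0 : ℤ) : W)) = dblW (e'.functor.obj ((0 : ℤ) : W)) at h
  rw [dblW_coe] at h
  exact shift_coe_dbl_ne 0 _ h

/-- Variant along `D ⋙ D`, for a lift `e'` that agrees with the shift on objects. [folklore] -/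
private theorem not_lift_shift_dbl_dbl (e' e'' : W ≌ W)
    (h' : ∀ x : W, e'.functor.obj x = shift.functor.obj x)
    (I : (dbl ⋙ dbl) ⋙ e'.functor ≅ e''.functor ⋙ (dbl ⋙ dbl)) : False := by
  have h := (I.app ((0 : ℤ) : W)).to_eq
  change e'.functor.obj (dblW (dblW ((0 : ℤ) : W))) = dblW (dblW (e''.functor.obj ((0 : ℤ) : W))) at h
  rw [h', dblW_coe, dblW_coe] at h
  exact shift_coe_dbl_ne (2 * 0) _ h

end DoublingWitness

open DoublingWitness Witness

namespace BadLocalFrobenioid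

variable (l : ℕ) (Kv : Type) [Field Kv] [ValuativeRel Kv]

/-- **The doubling inhabitant of `BadLocalFrobenioid l K_v`** (for every `l` and every valued field
`K_v`): all eight carriers `D_v, D⊢_v, F̲_v, F÷_v, C_v, C⊢_v, D^Θ_v, C^Θ_v` are the thin category
`W = ℤ ∪ {⊤}`; `D⊢_v ⊆ D_v`, `C_v ⊆ F̲_v`, `C⊢_v → D⊢_v`, `C⊢_v ⊆ C_v`, `C^Θ_v → D^Θ_v` are doubling,
`C^Θ_v ⊆ F÷_v` is doubling twice, `D^Θ_v ⊆ (D_v)_{Ÿ_v}` is doubling into the slice over `Ÿ_v := ⊤`;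
`F̲_v → D_v`, `F̲_v → F÷_v → D_v` identities; `D_v → D⊢_v` the reflector `⌈·/2⌉`; `q_v = q̲_v = 1`,
`Θ̲_v = id`, all splittings `⊥`, all monoids trivial. A toy serving only as a counter-model.
[claim: Mochizuki2012, status: disputed] -/
noncomputable def doubling : BadLocalFrobenioid.{0} l Kv where
  Dv := W
  Ddash := W
  incl := dbl
  proj := half
  adj := DoublingWitness.adj
  Fv := W
  toBase := 𝟭 W
  T := id
  T_base A := Iso.refl A
  Fbirat := W
  birat := 𝟭 W
  biratBase := 𝟭 W
  birat_base := ⟨NatIso.ofComponents (fun _ => Iso.refl _) (fun _ => Subsingleton.elim _ _)⟩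
  Ydd := ⊤
  unitsTY := ⊥
  unitsTY_comm x hx y hy := by rw [Subgroup.mem_bot] at hx hy; rw [hx, hy]
  theta := Iso.refl _
  theta_mem := Subgroup.mem_bot.mpr rfl
  lZ := ⊥
  Cv := W
  hull := dbl
  q := 1
  qroot := 1
  qroot_pow := one_pow _
  Cdash := W
  CdashBase := dbl
  CdashToC := dbl
  CdashToC_base := ⟨NatIso.ofComponents (fun _ => Iso.refl _) (fun _ => Subsingleton.elim _ _)⟩
  tauDashOf _ := botSplitting W
  DTheta := W
  DThetaIncl := dblOver
  prodEquiv := CategoryTheory.Equivalence.refl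
  OTheta := unitMon W
  OThetaUnits _ := ⊤
  OThetaUnits_isUnit _ x :=
    ⟨fun _ => @isUnit_of_subsingleton _ _ (inferInstanceAs (Subsingleton PUnit.{1})) x,
      fun _ => Submonoid.mem_top _⟩
  OThetaOf _ := unitMon W
  OThetaOf_theta := rfl
  CTheta := W
  CThetaBase := dbl
  CThetaToBirat := dbl ⋙ dbl
  CThetaToBirat_base := ⟨NatIso.ofComponents (fun _ => Iso.refl _) (fun _ => Subsingleton.elim _ _)⟩
  tauThetaOf _ := botSplitting W
  dashThetaEquiv := CategoryTheory.Equivalence.refl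
  dashThetaEquiv_tau := DoublingWitness.bot_isPreservedBy _
  dashThetaEquiv_base := ⟨NatIso.ofComponents (fun _ => Iso.refl _) (fun _ => Subsingleton.elim _ _)⟩

/-- Ex. 3.2 (vi) (a) as typed, `DdashFromD` ("`D⊢_v ⊆ D_v` may be reconstructed category-theoretically
from `D_v`", [AbsAnab] Lem. 1.3.8), FAILS on the doubling inhabitant: the shift of `D_v` does not
preserve the reflective full subcategory `D⊢_v = 2ℤ ∪ {⊤}`. [claim: Mochizuki2012, status: disputed] -/
theorem doubling_not_ddashFromD : ¬ (doubling l Kv).DdashFromD := fun h =>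
  not_exists_lift_shift (h shift)

/-- Ex. 3.2 (vi) (b) as typed, `DThetaFromD` ("`D^Θ_v` may be reconstructed category-theoretically from
`D_v`"), FAILS on the doubling inhabitant. [claim: Mochizuki2012, status: disputed] -/
theorem doubling_not_dThetaFromD : ¬ (doubling l Kv).DThetaFromD := fun h =>
  not_exists_lift_shift (h shift)

/-- Ex. 3.2 (iii) as typed, `CFromF` ("`C_v ⊆ F̲_v` may be reconstructed category-theoretically from
`F̲_v`", [EtTh] Cor. 3.8 (ii)), FAILS on the doubling inhabitant. [claim: Mochizuki2012, status: disputed] -/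
theorem doubling_not_cFromF : ¬ (doubling l Kv).CFromF := fun h =>
  not_exists_lift_shift (h shift)

/-- Ex. 3.2 (vi) (f) as typed, `FdashFromC` ("`F⊢_v` may be reconstructed category-theoretically from
`C_v`"), FAILS on the doubling inhabitant (already its first conjunct: the shift of `C_v` does not lift
to `C⊢_v`). [claim: Mochizuki2012, status: disputed] -/
theorem doubling_not_fdashFromC : ¬ (doubling l Kv).FdashFromC := fun h => by
  obtain ⟨e', ⟨I⟩, -⟩ := h shift
  exact not_exists_lift_shift ⟨e', ⟨I⟩⟩

/-- Ex. 3.2 (vi) (e) as typed, `FthetaFromF` ("`F^Θ_v` may be reconstructed category-theoretically from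
`F̲_v`"), FAILS on the doubling inhabitant: a lift `e'` of the shift along `F̲_v → F÷_v = id` IS the
shift on objects, and the shift does not lift along `C^Θ_v ⊆ F÷_v` (= doubling twice).
[claim: Mochizuki2012, status: disputed] -/
theorem doubling_not_fthetaFromF : ¬ (doubling l Kv).FthetaFromF := fun h => by
  obtain ⟨e', e'', ⟨I₁⟩, ⟨I₂⟩, -⟩ := h shift
  refine not_lift_shift_dbl_dbl e' e'' (fun x => ?_) I₂
  exact ((I₁.app x).to_eq).trans rfl

/-- **Independence certificate for DAG nodes `IUTchI:Ex3.2(i)`–`(vi)`**: the interface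
`BadLocalFrobenioid l K_v` has an inhabitant on which the typed reconstruction clauses Ex. 3.2 (iii)
`CFromF`, (vi)(a) `DdashFromD`, (vi)(b) `DThetaFromD`, (vi)(e) `FthetaFromF`, (vi)(f) `FdashFromC` are
all FALSE. Together with `BadLocalFrobenioid.exists_ex32Claims` (an inhabitant on which all ten clauses
hold) this certifies: these clauses are independent of the interface — neither dischargeable from it nor
vacuous — i.e. they are hypotheses on the real construction, to be proved at merge. [claim: Mochizuki2012, status: disputed] -/
theorem exists_not_ex32Reconstruction :
    ∃ B : BadLocalFrobenioid.{0} l Kv,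
      ¬ B.CFromF ∧ ¬ B.DdashFromD ∧ ¬ B.DThetaFromD ∧ ¬ B.FthetaFromF ∧ ¬ B.FdashFromC :=
  ⟨doubling l Kv, doubling_not_cFromF l Kv, doubling_not_ddashFromD l Kv, doubling_not_dThetaFromD l Kv,
    doubling_not_fthetaFromF l Kv, doubling_not_fdashFromC l Kv⟩

/-- In particular none of `CFromF`, `DdashFromD`, `DThetaFromD`, `FthetaFromF`, `FdashFromC` is a theorem
about ALL inhabitants of the interface. [claim: Mochizuki2012, status: disputed] -/
theorem not_forall_ex32Reconstruction :
    ¬ (∀ B : BadLocalFrobenioid.{0} l Kv, B.CFromF) ∧ ¬ (∀ B : BadLocalFrobenioid.{0} l Kv, B.DdashFromD) ∧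
    ¬ (∀ B : BadLocalFrobenioid.{0} l Kv, B.DThetaFromD) ∧ ¬ (∀ B : BadLocalFrobenioid.{0} l Kv, B.FthetaFromF) ∧
    ¬ (∀ B : BadLocalFrobenioid.{0} l Kv, B.FdashFromC) :=
  ⟨fun h => doubling_not_cFromF l Kv (h _), fun h => doubling_not_ddashFromD l Kv (h _),
    fun h => doubling_not_dThetaFromD l Kv (h _), fun h => doubling_not_fthetaFromF l Kv (h _),
    fun h => doubling_not_fdashFromC l Kv (h _)⟩

end BadLocalFrobenioid

end Literature.IUT.HodgeTheaters

end
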